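import Literature.MathematicalPhysics.QuantumFieldTheory.Balaban1983to89.B9SmoothHolderClassT
import Literature.MathematicalPhysics.QuantumFieldTheory.Balaban1983to89.B11SectGGradedClass
import Literature.MathematicalPhysics.QuantumFieldTheory.Balaban1983to89.B9Thm310CommutatorBound389B

/-!
# `Balaban1983to89.B9SmoothHolderClassGraded` — the GRADED transported smooth-partition Hölder classes `bHZG g p w` (sites) and `bHZKG g p w` (bonds):
# `loc_* := ⨆_{0<s<1} w(s)·loc^{(s)}` over the exponent-`s` transported classes `bHZT g s p ∕ bHZKT g s p` — ONE class in which every rows-20–21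
# intermediate is PRODUCED with a scalar constant (sup input, print's (3.43): exponent < 1 only) and CONSUMED at any exponent `s(β) ∈ (β,1)` (print's (3.45))

T. Bałaban, *Propagators for lattice gauge theories in a background field*, Commun. Math. Phys. **99** (1985) 389–434
[`Balaban1985BackgroundPropagators`, "B9"]; [4] = T. Bałaban, *Propagators and renormalization transformations for lattice gauge
theories. II*, Commun. Math. Phys. **96** (1984) 223–250 [`Balaban1984PropagatorsII`].

statement-level skeleton of published theorems with citation tags; proofs where landed; nothing here is a claim about the
Yang–Mills mass gap

THE PRINTED LOCI.  [B9] Thm 3.1 p. 397 L34–36 (*"B₀(β) → ∞ if β → 1"*), (3.43)–(3.45) p. 398 (*"B′₀(ε,β) → ∞ if either ε → 0, or β → 1"*), (3.40) p. 397;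
[4] (2.51)–(2.52) p. 232, (2.67) p. 234 (*"Lʲη ≦ 1"*).

WHY THIS FILE (cell `pub-ymgap`, node N06, seat dag-n06-l g21; LOCATED-U5 «the exponent of the shared Hölder intermediates», HOME `BH13-EXPONENT-MEMO.md`, and the
knit's WORD-TZ «OPTION (2) = transported classes»).  The certificate's free intermediates `bH13` (gauge modes) and `bXH` (vector fields) are each shared by
sup-input PRODUCERS (`rgdH`, `tbH ∕ tb₂H`, `gXH` — print-derivable into exponent `s < 1` only) and ∀β<1 Hölder CONSUMERS (`pYDH β`, `hXd β`, `pWE β` — needing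
exponent `> β`): no single exponent serves both (U5).  The graded class does: §1 the exponent index `Expo = {s // 0 < s < 1}` and the DOMINATION of every
weighted member size by the exponent-1 size (`w ≤ 1`; the Hölder pair weight `((|Δz|η)^s)⁻¹` is monotone in `s` on near pairs since `|Δz|η ≤ 1`:
`wEta_mono ∕ wEtaK_mono`, `bHZT_loc_mono ∕ bHZKT_loc_mono`); §2 ★★ `bHZG i b g h1p w hw0 hw1` and ★★ `bHZKG …` := `B11SectGGradedClass.BlockNorm.graded` over
`s ∈ Expo` of `bHZT g s p ∕ bHZKT g s p` (`p ≥ 1`), weights `w : ℝ → ℝ` with `0 ≤ w ≤ 1`, cost `1 + C_Lip`, base index `s = 1∕2`; `…_κ` (rfl: **1 + C_Lip(d, L)**,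
member- and `U`-uniform), `…_isLoc_iff`, `…_cut_apply`, `…_isLoc_of_blkOf ∕ _of_blkV1`; §3 the two directions every supplier uses: ★★ `hasMaj_from_bHZG ∕ _from_bHZKG`
(OUT at one exponent `s`, constant `(w s)⁻¹·K`) and ★★ `hasMaj_into_bHZG ∕ _into_bHZKG` (IN from the ∀s family with `w(s)·K_s ≤ K₀`).
THE PIN (knit's call, recipe): `bH13 x U := weightNorm (bHZG x.toKIdx (trBasis N) (parS-table of U) h1p w13 …) (Lʲη)⁻¹`, `bXH x U := bHZKG … (parB-table of U) … wX …`
with displayed weight functions `w13 wX` (`0 ≤ w ≤ 1`, `0 < w s` on `(0,1)`); `hκ13 ∕ hκX` by `bHZG_κ ∕ bHZKG_κ`.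
HONEST SCOPE.  Definitions + bookkeeping over landed objects; nothing of [B9]∕[4] asserted; no majorant of an operator, no certificate edit; COUNT-NEUTRAL; N06 NOT
discharged; nothing continuum, nothing about the mass gap.  Cell `pub-ymgap` (HUMAN RULING D-0062), Track A node N06 [B9], seat `pub-ymgap-dag-n06-l` (g21), 2026-08-28.
-/

noncomputable section

namespace Literature.MathematicalPhysics.QuantumFieldTheory.Balaban1983to89.B9SmoothHolderClassGraded

open B4TorusKernel.MultiPeriod (torusSupNorm)
open B6Geom246MultiLevelBox (blkOf scale_bounds)
open B6GlobalChartV1 (PV blkV1)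
open B6Ineq2142KLevelV1 (β lvl)
open B6KLevelCensusIndexV1 (KIdx)
open B6Prop22KLevelTorusCensusEta (nKT one_le_nKT one_le_torusSupNorm_sub)
open B9GeoNormsKLevelV1 (geo9K)
open B9Thm34Ext (toB6)
open B11SectG (BlockNorm HasMaj)
open B11SectGGlobal (Size)
open B11SectGGlobalSizes
open B11SectGSmoothCutT (Size.ofPairsT ofPairsT_sz_mono_weight)
open B11SectGGradedClass (graded_κ graded_isLoc graded_cut hasMaj_from_graded hasMaj_into_graded le_graded_loc member_loc_le)
open B9CoReadingCoords (XBK)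
open B9CoReadingCoordsS (XSK)
open B9MultiscaleSmoothPartitionY (zeta NearY levY_eq_blkOf nearY_of_blkOf_eq)
open B9MultiscaleSmoothPartitionYLip (CLip CLip_nonneg)
open B9SmoothHolderClassS (NearPair wEta wEta_nonneg Wscl Wscl_nonneg)
open B9SmoothHolderClassK (srcY NearPairK wEtaK wEtaK_nonneg wEtaK_eq torusSupNorm_srcY_pos blkV1_eq_blkOf_srcY)
open B9SmoothHolderClassT (trDif bHZT bHZT_κ bHZT_loc bHZT_isLoc_iff bHZT_cut_apply bHZT_isLoc_of_blkOf bHZKT bHZKT_κ bHZKT_loc bHZKT_isLoc_iff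
  bHZKT_cut_apply bHZKT_isLoc_of_blkV1)
open Node00 (SiteY FBondY IBondY toKT levY)
open B9Thm310CommutatorBound389B (levY_le_k)

variable {d ℓ : ℕ} {hd : 1 ≤ d + 1} {hL : Odd (ℓ + 1) ∧ 1 < ℓ + 1} {b₀ b₁ : ℝ}
variable {𝔸 : Type} [NormedRing 𝔸] [NormedAlgebra ℂ 𝔸]
variable {κ : Type} [Fintype κ]

/-! ## §1 The exponent index and the domination by the exponent-1 size -/

/-- **THE EXPONENT INDEX** of the graded Hölder classes: `s ∈ (0, 1)` (print's Hölder exponents `0 < β < 1`; the consumers of a β-member read at `s(β) = (1+β)∕2`).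
[cite: Balaban1985BackgroundPropagators, Thm 3.1 p.397 («0 ≦ β < 1»), dictionary] -/
abbrev Expo : Type := {s : ℝ // 0 < s ∧ s < 1}

/-- the base index `s = 1∕2`. [cite: Balaban1985BackgroundPropagators, (3.44) p.398 (any fixed 0 < ε ≤ 1), dictionary] -/
def expoHalf : Expo := ⟨1 / 2, by norm_num, by norm_num⟩

section Mono

variable (i : KIdx d ℓ hd hL b₀ b₁)

omit [Fintype κ] in
/-- ★ the η-scale Hölder pair weight is MONOTONE IN THE EXPONENT on near pairs: `|z − z′|_T ≤ L^{lev z} ≤ Lᵏ`, so `u := |z−z′|_T∕Lᵏ ∈ (0,1]` and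
`(u^s)⁻¹ ≤ (u^{s′})⁻¹` for `s ≤ s′`. [cite: Balaban1984PropagatorsII, (2.1) p.224 («Lʲη ≦ 1»); Balaban1985BackgroundPropagators, (3.40) p.397] -/
theorem wEta_mono {s s' : ℝ} (hss : s ≤ s') {p q : XSK κ i} (hP : NearPair i p q) : wEta i s p q ≤ wEta i s' p q := by
  have hL1 : (1 : ℝ) ≤ ((ℓ + 1 : ℕ) : ℝ) := by exact_mod_cast Nat.succ_le_succ (Nat.zero_le ℓ)
  have hn : (0 : ℝ) < (nKT (toKT i) : ℝ) := by exact_mod_cast lt_of_lt_of_le Nat.zero_lt_one (one_le_nKT (toKT i))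
  have ht1 : (1 : ℝ) ≤ torusSupNorm (toKT i).NB (p.1.1 - q.1.1) := one_le_torusSupNorm_sub (toKT i) hP.1
  have htk : torusSupNorm (toKT i).NB (p.1.1 - q.1.1) ≤ (nKT (toKT i) : ℝ) := by
    refine hP.2.1.trans ?_
    rw [nKT, Nat.cast_pow]
    exact pow_le_pow_right₀ hL1 (levY_le_k i p.1)
  have hu0 : 0 < torusSupNorm (toKT i).NB (p.1.1 - q.1.1) / (nKT (toKT i) : ℝ) := div_pos (lt_of_lt_of_le one_pos ht1) hn
  have hu1 : torusSupNorm (toKT i).NB (p.1.1 - q.1.1) / (nKT (toKT i) : ℝ) ≤ 1 := (div_le_one hn).2 htk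
  unfold wEta
  exact inv_anti₀ (Real.rpow_pos_of_pos hu0 _) (Real.rpow_le_rpow_of_exponent_ge hu0 hu1 hss)

omit [Fintype κ] in
/-- ★ the bond twin: the pair weight `wEtaK` is monotone in the exponent on near (admissible, distinct) pairs. [cite: Balaban1984PropagatorsII, (2.1) p.224 + (2.137) p.247; Balaban1985BackgroundPropagators, (3.40) p.397] -/
theorem wEtaK_mono {s s' : ℝ} (hss : s ≤ s') {p q : XBK κ i} (hP : NearPairK i p q) : wEtaK i s p q ≤ wEtaK i s' p q := by
  have hL1 : (1 : ℝ) ≤ ((ℓ + 1 : ℕ) : ℝ) := by exact_mod_cast Nat.succ_le_succ (Nat.zero_le ℓ)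
  have hn : (0 : ℝ) < (nKT (toKT i) : ℝ) := by exact_mod_cast lt_of_lt_of_le Nat.zero_lt_one (one_le_nKT (toKT i))
  have ht0 : (0 : ℝ) < (LatticeFieldCalculus.supDist p.1.src q.1.src : ℝ) := by
    have h := torusSupNorm_srcY_pos i hP
    have heq := wEtaK_eq i 1 p q
    -- `|chart s − chart s′|_T = supDist s s′`
    have : (LatticeFieldCalculus.supDist p.1.src q.1.src : ℝ) = torusSupNorm (toKT i).NB ((srcY i p).1 - (srcY i q).1) := by
      have := B9GradViaDivLettersAtPinsHolderPairs.torusSupNorm_chartY_sub i p.1.src q.1.src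
      rw [srcY, srcY, this]
    rw [this]; exact h
  have htk : (LatticeFieldCalculus.supDist p.1.src q.1.src : ℝ) ≤ (nKT (toKT i) : ℝ) := by
    have h1 : (LatticeFieldCalculus.supDist p.1.src q.1.src : ℝ) ≤ (((ℓ + 1 : ℕ) : ℝ)) ^ (blkV1 i.hN i.D p.1).1.1 := by exact_mod_cast hP.2.1.2.1
    refine h1.trans ?_
    rw [nKT, Nat.cast_pow]
    exact pow_le_pow_right₀ hL1 (by rw [blkV1_eq_blkOf_srcY]; exact (scale_bounds i.D.toDomains _).2)
  have hu0 : 0 < (LatticeFieldCalculus.supDist p.1.src q.1.src : ℝ) / (nKT (toKT i) : ℝ) := div_pos ht0 hn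
  have hu1 : (LatticeFieldCalculus.supDist p.1.src q.1.src : ℝ) / (nKT (toKT i) : ℝ) ≤ 1 := (div_le_one hn).2 htk
  unfold wEtaK
  exact inv_anti₀ (Real.rpow_pos_of_pos hu0 _) (Real.rpow_le_rpow_of_exponent_ge hu0 hu1 hss)

variable [Fintype (geo9K i).Site] (b : Module.Basis κ ℝ 𝔸)

/-- ★ **DOMINATION**: the exponent-`s` transported site class is below the exponent-`s′` one, size by size, for `s ≤ s′` (same sup power `p`).
[cite: Balaban1985BackgroundPropagators, (3.40) p.397; Balaban1984PropagatorsII, (2.1) p.224] -/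
theorem bHZT_loc_mono (g : SiteY i → SiteY i → 𝔸ˣ) {R : ℝ} {H : Prop} {s s' p : ℝ} (hs0 : 0 ≤ s) (hs1 : s ≤ 1) (hsp : s ≤ p)
    (hs0' : 0 ≤ s') (hs1' : s' ≤ 1) (hsp' : s' ≤ p) (hss : s ≤ s') (y : IBondY i) (F : XSK κ i → ℝ) :
    (bHZT (κ := κ) i b g (R := R) (H := H) hs0 hs1 hsp).loc y F ≤ (bHZT (κ := κ) i b g (R := R) (H := H) hs0' hs1' hsp').loc y F := by
  classical
  rw [bHZT_loc, bHZT_loc]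
  exact add_le_add le_rfl (ofPairsT_sz_mono_weight (g := toB6 (geo9K i) R H) (fun (q : XSK κ i) (y : IBondY i) => NearY i y q.1) (NearPair i) (wEta i s)
    (wEta_nonneg i s) (trDif b g) (wEta_nonneg i s') (fun q q' _ hP => wEta_mono i hss hP) F)

/-- ★ the bond twin of the domination. [cite: Balaban1985BackgroundPropagators, (3.40) p.397; Balaban1984PropagatorsII, (2.1) p.224] -/
theorem bHZKT_loc_mono (g : FBondY i → FBondY i → 𝔸ˣ) {R : ℝ} {H : Prop} {s s' p : ℝ} (hs0 : 0 ≤ s) (hs1 : s ≤ 1) (hsp : s ≤ p)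
    (hs0' : 0 ≤ s') (hs1' : s' ≤ 1) (hsp' : s' ≤ p) (hss : s ≤ s') (y : IBondY i) (F : XBK κ i → ℝ) :
    (bHZKT (κ := κ) i b g (R := R) (H := H) hs0 hs1 hsp).loc y F ≤ (bHZKT (κ := κ) i b g (R := R) (H := H) hs0' hs1' hsp').loc y F := by
  classical
  rw [bHZKT_loc, bHZKT_loc]
  exact add_le_add le_rfl (ofPairsT_sz_mono_weight (g := toB6 (geo9K i) R H) (fun (q : XBK κ i) (y : IBondY i) => NearY i y (srcY i q)) (NearPairK i) (wEtaK i s)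
    (wEtaK_nonneg i s) (trDif b g) (wEtaK_nonneg i s') (fun q q' _ hP => wEtaK_mono i hss hP) F)

end Mono

/-! ## §2 ★★ The graded transported classes -/

section Graded

variable (i : KIdx d ℓ hd hL b₀ b₁) [Fintype (geo9K i).Site] (b : Module.Basis κ ℝ 𝔸)

/-- the weights on the exponent index. [cite: Balaban1985BackgroundPropagators, Thm 3.1 p.397 («B₀(β)»), dictionary] -/
def wE (w : ℝ → ℝ) : Expo → ℝ := fun s => w s.1

/-- the exponent-indexed FAMILY of transported site classes `s ↦ bHZT g s p` (`p ≥ 1`). [cite: Balaban1985BackgroundPropagators, (3.40) p.397 + (3.43) p.398, dictionary] -/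
def famS (g : SiteY i → SiteY i → 𝔸ˣ) {R : ℝ} {H : Prop} {p : ℝ} (h1p : 1 ≤ p) : Expo → BlockNorm (toB6 (geo9K i) R H) (XSK κ i → ℝ) :=
  fun s => bHZT (κ := κ) i b g (R := R) (H := H) (ε := s.1) (p := p) s.2.1.le s.2.2.le (s.2.2.le.trans h1p)

/-- the exponent-indexed FAMILY of transported bond classes `s ↦ bHZKT g s p` (`p ≥ 1`). [cite: Balaban1985BackgroundPropagators, (3.40) p.397 + (3.43) p.398, dictionary] -/
def famK (g : FBondY i → FBondY i → 𝔸ˣ) {R : ℝ} {H : Prop} {p : ℝ} (h1p : 1 ≤ p) : Expo → BlockNorm (toB6 (geo9K i) R H) (XBK κ i → ℝ) :=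
  fun s => bHZKT (κ := κ) i b g (R := R) (H := H) (ε := s.1) (p := p) s.2.1.le s.2.2.le (s.2.2.le.trans h1p)

/-- ★★ **THE GRADED TRANSPORTED HÖLDER CLASS OF THE SITE COORDINATE CARRIER** `bHZG g p w`: `BlockNorm.graded` over `s ∈ (0,1)` of the exponent-`s` transported
classes `bHZT g s p` (`p ≥ 1`, so `s ≤ p` throughout), weights `w s ∈ [0,1]`, cost `1 + C_Lip`, base index `1∕2`, dominated by the exponent-1 size.
`loc_* y F = ⨆_s w(s)·[(Lʲη)^{−p}·sup_{Δ̃(y)}|F| + sup_{near pairs} (η|Δz|_T)^{−s}·|Δ^U F|]`; cut `ζ_y·`; `IsLoc` = vanishing off `Δ̃(y)`.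
[cite: Balaban1985BackgroundPropagators, Thm 3.1 p.397 («B₀(β) → ∞ if β → 1») + (3.40) p.397 + (3.43)–(3.45) p.398; Balaban1984PropagatorsII, (2.51)–(2.52) p.232] -/
def bHZG (g : SiteY i → SiteY i → 𝔸ˣ) {R : ℝ} {H : Prop} {p : ℝ} (h1p : 1 ≤ p) (w : ℝ → ℝ) (hw0 : ∀ s, 0 ≤ w s) (hw1 : ∀ s, w s ≤ 1) :
    BlockNorm (toB6 (geo9K i) R H) (XSK κ i → ℝ) :=
  BlockNorm.graded (famS (κ := κ) i b g (R := R) (H := H) h1p) expoHalf (wE w) (1 + CLip d ℓ)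
    (fun y F => (bHZT (κ := κ) i b g (R := R) (H := H) (ε := 1) (p := p) zero_le_one le_rfl h1p).loc y F)
    (fun s => hw0 s.1) (fun _ => rfl) (fun s => le_of_eq (bHZT_κ i b g s.2.1.le s.2.2.le (s.2.2.le.trans h1p)))
    (fun s y F => (mul_le_of_le_one_left ((bHZT i b g s.2.1.le s.2.2.le (s.2.2.le.trans h1p)).loc_nonneg y F) (hw1 s.1)).trans
      (bHZT_loc_mono i b g s.2.1.le s.2.2.le (s.2.2.le.trans h1p) zero_le_one le_rfl h1p s.2.2.le y F))

/-- ★★ **THE GRADED TRANSPORTED HÖLDER CLASS OF THE BOND COORDINATE CARRIER** `bHZKG g p w` (the same over `bHZKT g s p`).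
[cite: Balaban1985BackgroundPropagators, Thm 3.1 p.397 + (3.40) p.397 + (3.43)–(3.45) p.398 + p.398 (remark after (3.47)); Balaban1984PropagatorsII, (2.51)–(2.52) p.232] -/
def bHZKG (g : FBondY i → FBondY i → 𝔸ˣ) {R : ℝ} {H : Prop} {p : ℝ} (h1p : 1 ≤ p) (w : ℝ → ℝ) (hw0 : ∀ s, 0 ≤ w s) (hw1 : ∀ s, w s ≤ 1) :
    BlockNorm (toB6 (geo9K i) R H) (XBK κ i → ℝ) :=
  BlockNorm.graded (famK (κ := κ) i b g (R := R) (H := H) h1p) expoHalf (wE w) (1 + CLip d ℓ)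
    (fun y F => (bHZKT (κ := κ) i b g (R := R) (H := H) (ε := 1) (p := p) zero_le_one le_rfl h1p).loc y F)
    (fun s => hw0 s.1) (fun _ => rfl) (fun s => le_of_eq (bHZKT_κ i b g s.2.1.le s.2.2.le (s.2.2.le.trans h1p)))
    (fun s y F => (mul_le_of_le_one_left ((bHZKT i b g s.2.1.le s.2.2.le (s.2.2.le.trans h1p)).loc_nonneg y F) (hw1 s.1)).trans
      (bHZKT_loc_mono i b g s.2.1.le s.2.2.le (s.2.2.le.trans h1p) zero_le_one le_rfl h1p s.2.2.le y F))

variable {R : ℝ} {H : Prop} {p : ℝ} (h1p : 1 ≤ p) (w : ℝ → ℝ) (hw0 : ∀ s, 0 ≤ w s) (hw1 : ∀ s, w s ≤ 1)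

section SiteAPI

variable (g : SiteY i → SiteY i → 𝔸ˣ)

/-- ★ the cutting cost is `1 + C_Lip(d, L)` — member-, exponent- and `U`-uniform. [cite: Balaban1984PropagatorsII, (2.52) p.232; Balaban1985BackgroundPropagators, (3.43) p.398] -/
theorem bHZG_κ : (bHZG (κ := κ) i b g (R := R) (H := H) h1p w hw0 hw1).κ = 1 + CLip d ℓ := rfl

/-- the cut-offs are those of (every member, e.g.) the exponent-`1∕2` class. [cite: Balaban1984PropagatorsII, (2.52) p.232, bookkeeping] -/
theorem bHZG_cut : (bHZG (κ := κ) i b g (R := R) (H := H) h1p w hw0 hw1).cut =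
    (bHZT (κ := κ) i b g (R := R) (H := H) (ε := 1 / 2) (p := p) expoHalf.2.1.le expoHalf.2.2.le (expoHalf.2.2.le.trans h1p)).cut := rfl

/-- the localisation predicate is that of the exponent-`1∕2` class (= every member's). [cite: Balaban1984PropagatorsII, (2.51) p.232, bookkeeping] -/
theorem bHZG_isLoc : (bHZG (κ := κ) i b g (R := R) (H := H) h1p w hw0 hw1).IsLoc =
    (bHZT (κ := κ) i b g (R := R) (H := H) (ε := 1 / 2) (p := p) expoHalf.2.1.le expoHalf.2.2.le (expoHalf.2.2.le.trans h1p)).IsLoc := rfl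

/-- localisation at `y` = the vector vanishes off `Δ̃(y)`. [cite: Balaban1985BackgroundPropagators, (3.44) p.398, bookkeeping] -/
theorem bHZG_isLoc_iff (y : IBondY i) (F : XSK κ i → ℝ) :
    (bHZG (κ := κ) i b g (R := R) (H := H) h1p w hw0 hw1).IsLoc y F ↔ ∀ q : XSK κ i, ¬ NearY i y q.1 → F q = 0 := by
  rw [bHZG_isLoc]; exact bHZT_isLoc_iff i b g _ _ _ y F

/-- the cut-off is the multiplication by `ζ_y`. [cite: Balaban1985BackgroundPropagators, (3.43) p.398, bookkeeping] -/
theorem bHZG_cut_apply (y : IBondY i) (F : XSK κ i → ℝ) (q : XSK κ i) :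
    (bHZG (κ := κ) i b g (R := R) (H := H) h1p w hw0 hw1).cut y F q = zeta i y q.1 * F q := by
  rw [bHZG_cut]; exact bHZT_cut_apply i b g _ _ _ y F q

/-- sharp localisation over the carrier block implies localisation in `bHZG`. [cite: Balaban1985BackgroundPropagators, (3.44) p.398, bookkeeping] -/
theorem bHZG_isLoc_of_blkOf (y : IBondY i) (F : XSK κ i → ℝ) (hF : ∀ q : XSK κ i, blkOf i.D.toDomains q.1 ≠ β i.hN i.D i.hk y → F q = 0) :
    (bHZG (κ := κ) i b g (R := R) (H := H) h1p w hw0 hw1).IsLoc y F := by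
  rw [bHZG_isLoc]; exact bHZT_isLoc_of_blkOf i b g _ _ _ y F hF

variable {F₁ F₂ : Type} [AddCommGroup F₁] [Module ℝ F₁] [AddCommGroup F₂] [Module ℝ F₂]

/-- ★★ **OUT OF THE GRADED SITE CLASS AT ONE EXPONENT** (the consumer's projection): a majorant `K ≥ 0` of `T` out of the exponent-`s` class (`0 < s < 1`,
`0 < w s`) is the majorant `(w s)⁻¹·K` out of `bHZG` — the β-member of a composite reads λ at `s = s(β)` with print's β-dependent constant.
[cite: Balaban1985BackgroundPropagators, (3.44)–(3.45) p.398 («B′₀(ε,β)»); Balaban1984PropagatorsII, (2.51) p.232] -/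
theorem hasMaj_from_bHZG {b₂ : BlockNorm (toB6 (geo9K i) R H) F₂} {T : (XSK κ i → ℝ) →ₗ[ℝ] F₂} {K : IBondY i → IBondY i → ℝ}
    {s : ℝ} (hs0 : 0 < s) (hs1 : s < 1) (hws : 0 < w s) (hK : ∀ a c, 0 ≤ K a c)
    (h : HasMaj (bHZT (κ := κ) i b g (R := R) (H := H) (ε := s) (p := p) hs0.le hs1.le (hs1.le.trans h1p)) b₂ T K) :
    HasMaj (bHZG (κ := κ) i b g (R := R) (H := H) h1p w hw0 hw1) b₂ T (fun y y' => (w s)⁻¹ * K y y') := by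
  unfold bHZG
  exact hasMaj_from_graded (b := famS (κ := κ) i b g (R := R) (H := H) h1p) (i₀ := expoHalf) (w := wE w) (⟨s, hs0, hs1⟩ : Expo) hws
    (fun _ _ hl => hl) hK h

/-- ★★ **INTO THE GRADED SITE CLASS FROM THE WHOLE FAMILY** (the producer lands once): majorants `K s` into every exponent-`s` class with `w(s)·K s ≤ K₀`
(`K₀ ≥ 0`) give the majorant `K₀` into `bHZG` — a sup-input producer whose exponent-`s` constant blows up as `s → 1` lands with ONE scalar constant.
[cite: Balaban1985BackgroundPropagators, Thm 3.1 p.397 («B₀(β) → ∞ if β → 1») + (3.43) p.398; Balaban1984PropagatorsII, (2.51) p.232] -/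
theorem hasMaj_into_bHZG {b₁ : BlockNorm (toB6 (geo9K i) R H) F₁} {T : F₁ →ₗ[ℝ] (XSK κ i → ℝ)} {K : ℝ → IBondY i → IBondY i → ℝ}
    {K₀ : IBondY i → IBondY i → ℝ} (hK₀ : ∀ a c, 0 ≤ K₀ a c) (hKle : ∀ s, 0 < s → s < 1 → ∀ a c, w s * K s a c ≤ K₀ a c)
    (h : ∀ (s : ℝ) (hs0 : 0 < s) (hs1 : s < 1), HasMaj b₁ (bHZT (κ := κ) i b g (R := R) (H := H) (ε := s) (p := p) hs0.le hs1.le (hs1.le.trans h1p)) T (K s)) :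
    HasMaj b₁ (bHZG (κ := κ) i b g (R := R) (H := H) h1p w hw0 hw1) T K₀ := by
  unfold bHZG
  exact hasMaj_into_graded (b := famS (κ := κ) i b g (R := R) (H := H) h1p) (i₀ := expoHalf) (w := wE w)
    (K := fun s : Expo => K s.1) hK₀ (fun s => hKle s.1 s.2.1 s.2.2) fun s => h s.1 s.2.1 s.2.2

/-- a member size is controlled by the graded size: `loc^{(s)} ≤ (w s)⁻¹·loc_*` (`0 < s < 1`, `0 < w s`). [cite: Balaban1985BackgroundPropagators, (3.45) p.398, bookkeeping] -/
theorem bHZT_loc_le_bHZG {s : ℝ} (hs0 : 0 < s) (hs1 : s < 1) (hws : 0 < w s) (y : IBondY i) (F : XSK κ i → ℝ) :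
    (bHZT (κ := κ) i b g (R := R) (H := H) (ε := s) (p := p) hs0.le hs1.le (hs1.le.trans h1p)).loc y F ≤
      (w s)⁻¹ * (bHZG (κ := κ) i b g (R := R) (H := H) h1p w hw0 hw1).loc y F := by
  unfold bHZG
  exact member_loc_le (b := famS (κ := κ) i b g (R := R) (H := H) h1p) (i₀ := expoHalf) (w := wE w) (⟨s, hs0, hs1⟩ : Expo) hws _ _

end SiteAPI

section BondAPI

variable (g : FBondY i → FBondY i → 𝔸ˣ)

/-- ★ the cutting cost of the graded bond class is `1 + C_Lip(d, L)`. [cite: Balaban1984PropagatorsII, (2.52) p.232; Balaban1985BackgroundPropagators, (3.43) p.398] -/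
theorem bHZKG_κ : (bHZKG (κ := κ) i b g (R := R) (H := H) h1p w hw0 hw1).κ = 1 + CLip d ℓ := rfl

/-- the cut-offs are those of the exponent-`1∕2` member. [cite: Balaban1984PropagatorsII, (2.52) p.232, bookkeeping] -/
theorem bHZKG_cut : (bHZKG (κ := κ) i b g (R := R) (H := H) h1p w hw0 hw1).cut =
    (bHZKT (κ := κ) i b g (R := R) (H := H) (ε := 1 / 2) (p := p) expoHalf.2.1.le expoHalf.2.2.le (expoHalf.2.2.le.trans h1p)).cut := rfl

/-- the localisation predicate is that of the exponent-`1∕2` member. [cite: Balaban1984PropagatorsII, (2.51) p.232, bookkeeping] -/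
theorem bHZKG_isLoc : (bHZKG (κ := κ) i b g (R := R) (H := H) h1p w hw0 hw1).IsLoc =
    (bHZKT (κ := κ) i b g (R := R) (H := H) (ε := 1 / 2) (p := p) expoHalf.2.1.le expoHalf.2.2.le (expoHalf.2.2.le.trans h1p)).IsLoc := rfl

/-- localisation at `y` = the bond vector vanishes at bonds sourced off `Δ̃(y)`. [cite: Balaban1985BackgroundPropagators, (3.44) p.398 + p.398 (remark after (3.47)), bookkeeping] -/
theorem bHZKG_isLoc_iff (y : IBondY i) (F : XBK κ i → ℝ) :
    (bHZKG (κ := κ) i b g (R := R) (H := H) h1p w hw0 hw1).IsLoc y F ↔ ∀ q : XBK κ i, ¬ NearY i y (srcY i q) → F q = 0 := by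
  rw [bHZKG_isLoc]; exact bHZKT_isLoc_iff i b g _ _ _ y F

/-- the cut-off is the multiplication by `ζ_y` at the source site. [cite: Balaban1985BackgroundPropagators, (3.43) p.398, bookkeeping] -/
theorem bHZKG_cut_apply (y : IBondY i) (F : XBK κ i → ℝ) (q : XBK κ i) :
    (bHZKG (κ := κ) i b g (R := R) (H := H) h1p w hw0 hw1).cut y F q = zeta i y (srcY i q) * F q := by
  rw [bHZKG_cut]; exact bHZKT_cut_apply i b g _ _ _ y F q

/-- sharp localisation over the carrier block implies localisation in `bHZKG`. [cite: Balaban1985BackgroundPropagators, p.398 (remark after (3.47)), bookkeeping] -/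
theorem bHZKG_isLoc_of_blkV1 (y : IBondY i) (F : XBK κ i → ℝ) (hF : ∀ q : XBK κ i, blkV1 i.hN i.D q.1 ≠ β i.hN i.D i.hk y → F q = 0) :
    (bHZKG (κ := κ) i b g (R := R) (H := H) h1p w hw0 hw1).IsLoc y F := by
  rw [bHZKG_isLoc]; exact bHZKT_isLoc_of_blkV1 i b g _ _ _ y F hF

variable {F₁ F₂ : Type} [AddCommGroup F₁] [Module ℝ F₁] [AddCommGroup F₂] [Module ℝ F₂]

/-- ★★ **OUT OF THE GRADED BOND CLASS AT ONE EXPONENT** (constant `(w s)⁻¹·K`). [cite: Balaban1985BackgroundPropagators, (3.44)–(3.45) p.398; Balaban1984PropagatorsII, (2.51) p.232] -/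
theorem hasMaj_from_bHZKG {b₂ : BlockNorm (toB6 (geo9K i) R H) F₂} {T : (XBK κ i → ℝ) →ₗ[ℝ] F₂} {K : IBondY i → IBondY i → ℝ}
    {s : ℝ} (hs0 : 0 < s) (hs1 : s < 1) (hws : 0 < w s) (hK : ∀ a c, 0 ≤ K a c)
    (h : HasMaj (bHZKT (κ := κ) i b g (R := R) (H := H) (ε := s) (p := p) hs0.le hs1.le (hs1.le.trans h1p)) b₂ T K) :
    HasMaj (bHZKG (κ := κ) i b g (R := R) (H := H) h1p w hw0 hw1) b₂ T (fun y y' => (w s)⁻¹ * K y y') := by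
  unfold bHZKG
  exact hasMaj_from_graded (b := famK (κ := κ) i b g (R := R) (H := H) h1p) (i₀ := expoHalf) (w := wE w) (⟨s, hs0, hs1⟩ : Expo) hws
    (fun _ _ hl => hl) hK h

/-- ★★ **INTO THE GRADED BOND CLASS FROM THE WHOLE FAMILY** (`w(s)·K s ≤ K₀`). [cite: Balaban1985BackgroundPropagators, Thm 3.1 p.397 + (3.43) p.398; Balaban1984PropagatorsII, (2.51) p.232] -/
theorem hasMaj_into_bHZKG {b₁ : BlockNorm (toB6 (geo9K i) R H) F₁} {T : F₁ →ₗ[ℝ] (XBK κ i → ℝ)} {K : ℝ → IBondY i → IBondY i → ℝ}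
    {K₀ : IBondY i → IBondY i → ℝ} (hK₀ : ∀ a c, 0 ≤ K₀ a c) (hKle : ∀ s, 0 < s → s < 1 → ∀ a c, w s * K s a c ≤ K₀ a c)
    (h : ∀ (s : ℝ) (hs0 : 0 < s) (hs1 : s < 1), HasMaj b₁ (bHZKT (κ := κ) i b g (R := R) (H := H) (ε := s) (p := p) hs0.le hs1.le (hs1.le.trans h1p)) T (K s)) :
    HasMaj b₁ (bHZKG (κ := κ) i b g (R := R) (H := H) h1p w hw0 hw1) T K₀ := by
  unfold bHZKG
  exact hasMaj_into_graded (b := famK (κ := κ) i b g (R := R) (H := H) h1p) (i₀ := expoHalf) (w := wE w)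
    (K := fun s : Expo => K s.1) hK₀ (fun s => hKle s.1 s.2.1 s.2.2) fun s => h s.1 s.2.1 s.2.2

/-- a member size is controlled by the graded size: `loc^{(s)} ≤ (w s)⁻¹·loc_*`. [cite: Balaban1985BackgroundPropagators, (3.45) p.398, bookkeeping] -/
theorem bHZKT_loc_le_bHZKG {s : ℝ} (hs0 : 0 < s) (hs1 : s < 1) (hws : 0 < w s) (y : IBondY i) (F : XBK κ i → ℝ) :
    (bHZKT (κ := κ) i b g (R := R) (H := H) (ε := s) (p := p) hs0.le hs1.le (hs1.le.trans h1p)).loc y F ≤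
      (w s)⁻¹ * (bHZKG (κ := κ) i b g (R := R) (H := H) h1p w hw0 hw1).loc y F := by
  unfold bHZKG
  exact member_loc_le (b := famK (κ := κ) i b g (R := R) (H := H) h1p) (i₀ := expoHalf) (w := wE w) (⟨s, hs0, hs1⟩ : Expo) hws _ _

end BondAPI

end Graded

end Literature.MathematicalPhysics.QuantumFieldTheory.Balaban1983to89.B9SmoothHolderClassGraded
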